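import Literature.Geometry.Riemannian.SingularTimeLimitMetric
import Literature.Geometry.Riemannian.PerelmanNoncollapsingInterior
import HarnessLib

/-!
# Local distance distortion along a Ricci flow under a two-sided Ricci bound on a ball
# (Bamler 2020a, §9.2, "a standard distance distortion estimate")

R. Bamler, *Entropy and heat kernel bounds on a Ricci flow background*, arXiv:2008.07093 (2020a),
§9.2, proofs of Cor. 9.6 (arXiv v1 Cor. 34): containment relations between conventional parabolic
neighbourhoods `P(x₀, t₀; A r, −T⁻r², T⁺r²) = B(x₀, t₀, A r) × [t₀ − T⁻r², t₀ + T⁺r²]` and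
`P*`-parabolic neighbourhoods follow from Prop. 9.5 "and a standard distance distortion estimate".
The estimate meant is LOCAL: `|Ric| ≤ K₁` is only assumed on a `g_{t₀}`-ball, for all times of an
interval `J`. This file proves it for the tree's compact Ricci flows `IsRicciFlow g cov (Icc a T)`:

* `length_le_mul_length_of_val_le_on` — length comparison `L_{g₂}(γ) ≤ √c L_{g₁}(γ)` under
  `g₂ ≤ c g₁` along the curve only;
* `IsRicciFlow.val_le_exp_mul_val_of_ricci_bound_at` — `g_s(X, X) ≤ e^{2K₁|J|} g_{t'}(X, X)` for
  `s, t' ∈ J` at a point where `|Ric_τ(X, X)| ≤ K₁ g_τ(X, X)` for all `τ ∈ J` (Topping 2006,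
  Lemma 5.3.2 read pointwise, `IsRicciFlow.metric_equivalence_at`);
* `IsRicciFlow.edist_le_exp_mul_edist_of_ricci_bound_ball` — if `|Ric| ≤ K₁` on
  `B_{t₀}(p, ρ) × J` then `d_s(p, y) ≤ e^{K₁|J|} d_{t₀}(p, y)` for `y ∈ B_{t₀}(p, ρ)`, `s ∈ J`
  (almost minimising `g_{t₀}`-curves stay in the ball);
* `edist_le_exp_mul_edist_of_ricci_bound_ball_rev` — conversely
  `d_{t₀}(p, y) ≤ e^{K₁|J|} d_s(p, y)` whenever `e^{K₁|J|} d_s(p, y) < ρ` (continuity argument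
  along an almost minimising `g_s`-curve: it cannot leave the `g_{t₀}`-ball).

Everything is proved; no definitions, no named facts.

## References

* R. H. Bamler, *Entropy and heat kernel bounds on a Ricci flow background*, arXiv:2008.07093
  (2020), §9.2, proof of Cor. 9.6 (arXiv v1 Cor. 34). [Bamler2020Entropy]
* P. Topping, *Lectures on the Ricci flow*, LMS Lecture Note Series 325 (2006), Lemma 5.3.2.
  [Topping2006]
-/

noncomputable section

open Bundle Set Filter Function MeasureTheory Manifold
open scoped Manifold ContDiff Topology ENNReal NNReal

namespace Literature.Geometry.Riemannian

open Lorentzian Lorentzian.PseudoRiemannianMetric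

section Length

variable {E : Type*} [NormedAddCommGroup E] [NormedSpace ℝ E] [FiniteDimensional ℝ E]
  {H : Type*} [TopologicalSpace H] {I : ModelWithCorners ℝ E H}
  {M : Type*} [TopologicalSpace M] [ChartedSpace H M] [IsManifold I ∞ M]
  {g₁ g₂ : PseudoRiemannianMetric I ∞ E (TangentSpace I : M → Type _)}

/-- **Length comparison along a curve**: if `g₂(v, v) ≤ c g₁(v, v)` at the points `γ(t)`,
`t ∈ (a, b)`, then `L_{g₂}(γ|[a,b]) ≤ √c L_{g₁}(γ|[a,b])` (the endpoints are a null set).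
[cite: ONeill1983, Ch. 5, Def. 11 (p. 131)] -/
theorem _root_.Literature.Geometry.Lorentzian.PseudoRiemannianMetric.length_le_mul_length_of_val_le_on
    (h₁ : g₁.IsRiemannian) (h₂ : g₂.IsRiemannian) {c : ℝ} (hc : 0 ≤ c) {γ : ℝ → M} {a b : ℝ}
    (hle : ∀ t ∈ Ioo a b, ∀ v : TangentSpace I (γ t), g₂.val (γ t) v v ≤ c * g₁.val (γ t) v v) :
    g₂.length h₂ γ a b ≤ ENNReal.ofReal (Real.sqrt c) * g₁.length h₁ γ a b := by
  rw [length_eq_lintegral, length_eq_lintegral, ← lintegral_const_mul' _ _ ENNReal.ofReal_ne_top,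
    setLIntegral_congr Ioo_ae_eq_Icc.symm, setLIntegral_congr Ioo_ae_eq_Icc.symm]
  refine setLIntegral_mono' measurableSet_Ioo fun t ht ↦ ?_
  rw [← ENNReal.ofReal_mul (Real.sqrt_nonneg _), ← Real.sqrt_mul hc]
  exact ENNReal.ofReal_le_ofReal (Real.sqrt_le_sqrt (hle t ht _))

/-- `d(γ a, γ t) ≤ L(γ|[a,b])` for `t ∈ [a, b]` and `γ` of class `C¹` on `[a, b]`.
[cite: ONeill1983, Ch. 5, Def. 15 (p. 134)] -/
theorem _root_.Literature.Geometry.Lorentzian.PseudoRiemannianMetric.edist_le_length_of_mem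
    (h₁ : g₁.IsRiemannian) {γ : ℝ → M} {a b t : ℝ} (ht : t ∈ Icc a b)
    (hγ : ContMDiffOn 𝓘(ℝ, ℝ) I 1 γ (Icc a b)) :
    g₁.edist h₁ (γ a) (γ t) ≤ g₁.length h₁ γ a b :=
  calc g₁.edist h₁ (γ a) (γ t) ≤ g₁.length h₁ γ a t :=
        edist_le_length h₁ ht.1 (hγ.mono (Icc_subset_Icc le_rfl ht.2))
    _ ≤ g₁.length h₁ γ a b := by
        letI := g₁.riemannianBundle h₁
        exact pathELength_mono le_rfl ht.2

end Length

section Flow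

variable {m : ℕ} {M : Type*} [TopologicalSpace M] [ChartedSpace (EuclideanSpace ℝ (Fin m)) M]
  [IsManifold 𝓘(ℝ, EuclideanSpace ℝ (Fin m)) ∞ M] [T3Space M]
  {g : ℝ → PseudoRiemannianMetric 𝓘(ℝ, EuclideanSpace ℝ (Fin m)) ∞ (EuclideanSpace ℝ (Fin m))
    (TangentSpace 𝓘(ℝ, EuclideanSpace ℝ (Fin m)) : M → Type _)}
  {cov : ℝ → CovariantDerivative 𝓘(ℝ, EuclideanSpace ℝ (Fin m)) (EuclideanSpace ℝ (Fin m))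
    (TangentSpace 𝓘(ℝ, EuclideanSpace ℝ (Fin m)) : M → Type _)}
  {a T : ℝ}

omit [T3Space M] in
/-- **Pointwise metric comparison between two times under a Ricci bound at a point** (Topping
2006, Lemma 5.3.2, pointwise form): along a Ricci flow of Riemannian metrics on `[a, T]`, if
`|Ric_τ(x)(X, X)| ≤ K₁ g_τ(x)(X, X)` for all `τ ∈ [s₁, s₂] ⊆ [a, T]`, then for `s, t' ∈ [s₁, s₂]`,
`g_s(X, X) ≤ e^{2K₁(s₂−s₁)} g_{t'}(X, X)`. [cite: Topping2006, Lemma 5.3.2] -/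
theorem IsRicciFlow.val_le_exp_mul_val_of_ricci_bound_at (hflow : IsRicciFlow g cov (Icc a T))
    (hR : ∀ r, (g r).IsRiemannian) {s₁ s₂ : ℝ} (hJ : Icc s₁ s₂ ⊆ Icc a T) {K₁ : ℝ} (hK₁ : 0 ≤ K₁)
    (x : M) (X : TangentSpace 𝓘(ℝ, EuclideanSpace ℝ (Fin m)) x)
    (hRic : ∀ τ ∈ Icc s₁ s₂, |(cov τ).ricci x X X| ≤ K₁ * (g τ).val x X X)
    {s t' : ℝ} (hs : s ∈ Icc s₁ s₂) (ht' : t' ∈ Icc s₁ s₂) :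
    (g s).val x X X ≤ Real.exp (2 * K₁ * (s₂ - s₁)) * (g t').val x X X := by
  -- the flow on `[min s t', max s t']`
  set lo := min s t' with hlo
  set hi := max s t' with hhi
  have hlohi : Icc lo hi ⊆ Icc s₁ s₂ :=
    Icc_subset_Icc (le_min hs.1 ht'.1) (max_le hs.2 ht'.2)
  have hfl : IsRicciFlow g cov (Icc lo hi) := hflow.mono (hlohi.trans hJ)
  have key := fun t ht ↦ hfl.metric_equivalence_at (fun τ _ ↦ hR τ) x X
    (fun τ hτ ↦ hRic τ (hlohi hτ)) t ht
  have hΔ : hi - lo ≤ s₂ - s₁ := by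
    have h1 : s₁ ≤ lo := le_min hs.1 ht'.1
    have h2 : hi ≤ s₂ := max_le hs.2 ht'.2
    linarith
  have hE : Real.exp (2 * K₁ * (hi - lo)) ≤ Real.exp (2 * K₁ * (s₂ - s₁)) :=
    Real.exp_le_exp.2 (by nlinarith)
  have hpos : ∀ τ, 0 ≤ (g τ).val x X X := fun τ ↦ by
    by_cases hX : X = 0
    · subst hX; simp
    · exact (hR τ x X hX).le
  have hhi_mem : hi ∈ Icc lo hi := ⟨min_le_max, le_rfl⟩
  rcases le_total s t' with hst | hts
  · -- `s = lo`, `t' = hi`: lower bound `e^{-2K(hi-lo)} g_lo ≤ g_hi`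
    have hlo' : lo = s := min_eq_left hst
    have hhi' : hi = t' := max_eq_right hst
    have h1 := (key hi hhi_mem).1
    rw [hlo', hhi'] at h1
    rw [hlo', hhi'] at hE
    have hexp : Real.exp (-(2 * K₁ * (t' - s))) * Real.exp (2 * K₁ * (t' - s)) = 1 := by
      rw [← Real.exp_add, neg_add_cancel, Real.exp_zero]
    calc (g s).val x X X
        = Real.exp (2 * K₁ * (t' - s)) * (Real.exp (-(2 * K₁ * (t' - s))) * (g s).val x X X) := by
          rw [← mul_assoc, mul_comm (Real.exp _), hexp, one_mul]
      _ ≤ Real.exp (2 * K₁ * (t' - s)) * (g t').val x X X :=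
          mul_le_mul_of_nonneg_left h1 (Real.exp_pos _).le
      _ ≤ Real.exp (2 * K₁ * (s₂ - s₁)) * (g t').val x X X :=
          mul_le_mul_of_nonneg_right hE (hpos _)
  · -- `t' = lo`, `s = hi`: upper bound `g_hi ≤ e^{2K(hi-lo)} g_lo`
    have hlo' : lo = t' := min_eq_right hts
    have hhi' : hi = s := max_eq_left hts
    have h1 := (key hi hhi_mem).2
    rw [hlo', hhi'] at h1
    rw [hlo', hhi'] at hE
    exact h1.trans (mul_le_mul_of_nonneg_right hE (hpos _))

omit [T3Space M] in
/-- **Length distortion of a curve inside the ball** where `|Ric| ≤ K₁` holds at all times of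
`[s₁, s₂]`: `L_s(γ) ≤ e^{K₁(s₂−s₁)} L_{t'}(γ)` for `s, t' ∈ [s₁, s₂]`, if `γ(σ)` lies in the
`g_{t₀}`-ball `B_{t₀}(p, ρ)` for `σ ∈ (0, b)`. [cite: Bamler2020Entropy, §9.2, proof of Cor. 9.6] -/
theorem IsRicciFlow.length_le_exp_mul_length_of_ricci_bound_ball
    (hflow : IsRicciFlow g cov (Icc a T)) (hR : ∀ r, (g r).IsRiemannian) {s₁ s₂ : ℝ}
    (hJ : Icc s₁ s₂ ⊆ Icc a T) {K₁ : ℝ} (hK₁ : 0 ≤ K₁) {t₀ : ℝ} (p : M) {ρ : ℝ≥0∞}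
    (hRic : ∀ τ ∈ Icc s₁ s₂, ∀ y : M, (g t₀).edist (hR t₀) p y < ρ →
      ∀ X : TangentSpace 𝓘(ℝ, EuclideanSpace ℝ (Fin m)) y,
        |(cov τ).ricci y X X| ≤ K₁ * (g τ).val y X X)
    {s t' : ℝ} (hs : s ∈ Icc s₁ s₂) (ht' : t' ∈ Icc s₁ s₂) {γ : ℝ → M} {b : ℝ}
    (hγ : ∀ σ ∈ Ioo 0 b, (g t₀).edist (hR t₀) p (γ σ) < ρ) :
    (g s).length (hR s) γ 0 b ≤
      ENNReal.ofReal (Real.exp (K₁ * (s₂ - s₁))) * (g t').length (hR t') γ 0 b := by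
  have hsqrt : Real.sqrt (Real.exp (2 * K₁ * (s₂ - s₁))) = Real.exp (K₁ * (s₂ - s₁)) := by
    rw [show 2 * K₁ * (s₂ - s₁) = K₁ * (s₂ - s₁) + K₁ * (s₂ - s₁) by ring, Real.exp_add,
      Real.sqrt_mul_self (Real.exp_pos _).le]
  rw [← hsqrt]
  exact length_le_mul_length_of_val_le_on (hR t') (hR s) (Real.exp_pos _).le fun σ hσ X ↦
    hflow.val_le_exp_mul_val_of_ricci_bound_at hR hJ hK₁ (γ σ) X
      (fun τ hτ ↦ hRic τ hτ (γ σ) (hγ σ hσ) X) hs ht'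

omit [T3Space M] in
/-- **Local distance distortion, forward** (Bamler 2020a, §9.2, "a standard distance distortion
estimate"): if `|Ric_τ| ≤ K₁ g_τ` on the `g_{t₀}`-ball `B_{t₀}(p, ρ)` for all `τ ∈ [s₁, s₂]`
(`t₀ ∈ [s₁, s₂] ⊆ [a, T]`), then for every `y ∈ B_{t₀}(p, ρ)` and `s ∈ [s₁, s₂]`,
`d_s(p, y) ≤ e^{K₁(s₂−s₁)} d_{t₀}(p, y)` (almost minimising `g_{t₀}`-curves from `p` to `y` stay
in the ball). [cite: Bamler2020Entropy, §9.2, proof of Cor. 9.6 (arXiv v1 Cor. 34)] -/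
theorem IsRicciFlow.edist_le_exp_mul_edist_of_ricci_bound_ball
    (hflow : IsRicciFlow g cov (Icc a T)) (hR : ∀ r, (g r).IsRiemannian) {s₁ s₂ : ℝ}
    (hJ : Icc s₁ s₂ ⊆ Icc a T) {K₁ : ℝ} (hK₁ : 0 ≤ K₁) {t₀ : ℝ} (ht₀ : t₀ ∈ Icc s₁ s₂) (p : M)
    {ρ : ℝ≥0∞}
    (hRic : ∀ τ ∈ Icc s₁ s₂, ∀ y : M, (g t₀).edist (hR t₀) p y < ρ →
      ∀ X : TangentSpace 𝓘(ℝ, EuclideanSpace ℝ (Fin m)) y,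
        |(cov τ).ricci y X X| ≤ K₁ * (g τ).val y X X)
    {s : ℝ} (hs : s ∈ Icc s₁ s₂) {y : M} (hy : (g t₀).edist (hR t₀) p y < ρ) :
    (g s).edist (hR s) p y ≤
      ENNReal.ofReal (Real.exp (K₁ * (s₂ - s₁))) * (g t₀).edist (hR t₀) p y := by
  set k : ℝ≥0∞ := ENNReal.ofReal (Real.exp (K₁ * (s₂ - s₁))) with hk
  have hk0 : k ≠ 0 := (ENNReal.ofReal_pos.2 (Real.exp_pos _)).ne'
  have hktop : k ≠ ⊤ := ENNReal.ofReal_ne_top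
  rw [mul_comm, ← ENNReal.div_le_iff hk0 hktop]
  refine le_of_forall_gt_imp_ge_of_dense fun r hr ↦ ?_
  -- an almost minimising `g_{t₀}`-curve of length `< min r ρ`
  have hr' : (g t₀).edist (hR t₀) p y < min r ρ := lt_min hr hy
  letI := (g t₀).riemannianBundle (hR t₀)
  obtain ⟨γ, hγ0, hγ1, hγs, hlen⟩ :=
    exists_lt_of_riemannianEDist_lt (I := 𝓘(ℝ, EuclideanSpace ℝ (Fin m))) (x := p) (y := y) hr'
  have hlen' : (g t₀).length (hR t₀) γ 0 1 < min r ρ := hlen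
  -- the curve stays in the ball
  have hball : ∀ σ ∈ Ioo (0 : ℝ) 1, (g t₀).edist (hR t₀) p (γ σ) < ρ := by
    intro σ hσ
    rw [← hγ0]
    exact ((edist_le_length_of_mem (hR t₀) ⟨hσ.1.le, hσ.2.le⟩ hγs).trans_lt hlen').trans_le
      (min_le_right _ _)
  refine ENNReal.div_le_of_le_mul ?_
  calc (g s).edist (hR s) p y = (g s).edist (hR s) (γ 0) (γ 1) := by rw [hγ0, hγ1]
    _ ≤ (g s).length (hR s) γ 0 1 := edist_le_length _ zero_le_one hγs
    _ ≤ k * (g t₀).length (hR t₀) γ 0 1 :=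
        hflow.length_le_exp_mul_length_of_ricci_bound_ball hR hJ hK₁ p hRic hs ht₀ hball
    _ ≤ k * r := mul_le_mul' le_rfl (hlen'.le.trans (min_le_left _ _))
    _ = r * k := mul_comm _ _

/-- **Local distance distortion, backward** (Bamler 2020a, §9.2, "a standard distance distortion
estimate", the direction needed to place `g_s`-balls inside the `g_{t₀}`-ball carrying the
curvature bound): if `|Ric_τ| ≤ K₁ g_τ` on `B_{t₀}(p, ρ)` for all `τ ∈ [s₁, s₂] ∋ t₀`, then for
`s ∈ [s₁, s₂]` and every `y` with `e^{K₁(s₂−s₁)} d_s(p, y) < ρ`,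
`d_{t₀}(p, y) ≤ e^{K₁(s₂−s₁)} d_s(p, y)`. Proof: an almost minimising `g_s`-curve `γ` from `p` to
`y` cannot leave `B_{t₀}(p, ρ)` — at the first parameter `σ₁` with `d_{t₀}(p, γ σ₁) ≥ ρ` the
initial arc lies in the ball, so its `g_{t₀}`-length is at most `e^{K₁(s₂−s₁)} L_s(γ) < ρ`.
[cite: Bamler2020Entropy, §9.2, proof of Cor. 9.6 (arXiv v1 Cor. 34)] -/
theorem edist_le_exp_mul_edist_of_ricci_bound_ball_rev
    (hflow : IsRicciFlow g cov (Icc a T)) (hR : ∀ r, (g r).IsRiemannian) {s₁ s₂ : ℝ}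
    (hJ : Icc s₁ s₂ ⊆ Icc a T) {K₁ : ℝ} (hK₁ : 0 ≤ K₁) {t₀ : ℝ} (ht₀ : t₀ ∈ Icc s₁ s₂) (p : M)
    {ρ : ℝ≥0∞}
    (hRic : ∀ τ ∈ Icc s₁ s₂, ∀ y : M, (g t₀).edist (hR t₀) p y < ρ →
      ∀ X : TangentSpace 𝓘(ℝ, EuclideanSpace ℝ (Fin m)) y,
        |(cov τ).ricci y X X| ≤ K₁ * (g τ).val y X X)
    {s : ℝ} (hs : s ∈ Icc s₁ s₂) {y : M}
    (hy : ENNReal.ofReal (Real.exp (K₁ * (s₂ - s₁))) * (g s).edist (hR s) p y < ρ) :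
    (g t₀).edist (hR t₀) p y ≤
      ENNReal.ofReal (Real.exp (K₁ * (s₂ - s₁))) * (g s).edist (hR s) p y := by
  set k : ℝ≥0∞ := ENNReal.ofReal (Real.exp (K₁ * (s₂ - s₁))) with hk
  have hk0 : k ≠ 0 := (ENNReal.ofReal_pos.2 (Real.exp_pos _)).ne'
  have hktop : k ≠ ⊤ := ENNReal.ofReal_ne_top
  -- a radius `r₀ > d_s(p, y)` with `k r₀ < ρ`
  have hy' : (g s).edist (hR s) p y < ρ / k := by
    rw [ENNReal.lt_div_iff_mul_lt (Or.inl hk0) (Or.inl hktop), mul_comm]; exact hy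
  obtain ⟨r₀, hr₀, hr₀ρ⟩ := exists_between hy'
  have hkr₀ : k * r₀ < ρ := by rw [mul_comm]; exact ENNReal.mul_lt_of_lt_div hr₀ρ
  rw [mul_comm, ← ENNReal.div_le_iff hk0 hktop]
  refine le_of_forall_gt_imp_ge_of_dense fun r hr ↦ ?_
  -- an almost minimising `g_s`-curve of length `< min r r₀`
  have hr' : (g s).edist (hR s) p y < min r r₀ := lt_min hr hr₀
  letI := (g s).riemannianBundle (hR s)
  obtain ⟨γ, hγ0, hγ1, hγs, hlen⟩ :=
    exists_lt_of_riemannianEDist_lt (I := 𝓘(ℝ, EuclideanSpace ℝ (Fin m))) (x := p) (y := y) hr'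
  have hlen' : (g s).length (hR s) γ 0 1 < min r r₀ := hlen
  -- `g_{t₀}`-length of initial arcs inside the ball
  have harc : ∀ b ∈ Icc (0 : ℝ) 1, (∀ σ ∈ Ioo 0 b, (g t₀).edist (hR t₀) p (γ σ) < ρ) →
      (g t₀).edist (hR t₀) p (γ b) < ρ ∧ (g t₀).edist (hR t₀) p (γ b) ≤ k * r := by
    intro b hb hin
    have h1 : (g t₀).edist (hR t₀) p (γ b) ≤ k * (g s).length (hR s) γ 0 1 := by
      rw [← hγ0]
      calc (g t₀).edist (hR t₀) (γ 0) (γ b) ≤ (g t₀).length (hR t₀) γ 0 b :=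
            edist_le_length _ hb.1 (hγs.mono (Icc_subset_Icc le_rfl hb.2))
        _ ≤ k * (g s).length (hR s) γ 0 b :=
            hflow.length_le_exp_mul_length_of_ricci_bound_ball hR hJ hK₁ p hRic ht₀ hs hin
        _ ≤ k * (g s).length (hR s) γ 0 1 := by
            refine mul_le_mul' le_rfl ?_
            letI := (g s).riemannianBundle (hR s)
            exact pathELength_mono le_rfl hb.2
    refine ⟨h1.trans_lt ?_, h1.trans (mul_le_mul' le_rfl (hlen'.le.trans (min_le_left _ _)))⟩
    calc k * (g s).length (hR s) γ 0 1 ≤ k * r₀ :=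
          mul_le_mul' le_rfl (hlen'.le.trans (min_le_right _ _))
      _ < ρ := hkr₀
  -- the curve never leaves the ball (first exit parameter argument)
  have hall : ∀ σ ∈ Icc (0 : ℝ) 1, (g t₀).edist (hR t₀) p (γ σ) < ρ := by
    by_contra hcon
    push Not at hcon
    set A : Set ℝ := {σ | σ ∈ Icc (0 : ℝ) 1 ∧ ρ ≤ (g t₀).edist (hR t₀) p (γ σ)} with hA
    have hne : A.Nonempty := by
      obtain ⟨σ, hσ, hge⟩ := hcon
      exact ⟨σ, hσ, hge⟩
    have hbdd : BddBelow A := ⟨0, fun σ hσ ↦ hσ.1.1⟩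
    have hfc : ContinuousOn (fun σ ↦ (g t₀).edist (hR t₀) p (γ σ)) (Icc 0 1) :=
      ((PseudoRiemannianMetric.continuous_edist (hR t₀)).comp_continuousOn
        (continuousOn_const.prodMk hγs.continuousOn))
    have hAc : IsClosed A := hfc.preimage_isClosed_of_isClosed isClosed_Icc isClosed_Ici
    set σ₁ := sInf A with hσ₁
    have hσ₁A : σ₁ ∈ A := hAc.csInf_mem hne hbdd
    have hin : ∀ σ ∈ Ioo 0 σ₁, (g t₀).edist (hR t₀) p (γ σ) < ρ := by
      intro σ hσ
      by_contra hge
      rw [not_lt] at hge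
      have hσA : σ ∈ A := ⟨⟨hσ.1.le, hσ.2.le.trans hσ₁A.1.2⟩, hge⟩
      exact absurd (csInf_le hbdd hσA) (not_le.2 hσ.2)
    exact absurd (harc σ₁ hσ₁A.1 hin).1 (not_lt.2 hσ₁A.2)
  refine ENNReal.div_le_of_le_mul ?_
  rw [mul_comm r k, ← hγ1]
  exact (harc 1 ⟨zero_le_one, le_rfl⟩ fun σ hσ ↦ hall σ ⟨hσ.1.le, hσ.2.le⟩).2

end Flow

end Literature.Geometry.Riemannian

end
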